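import Literature.Barriers.CriticalPhenomena.PositionSpaceRGNonGibbsianExtremal
import Literature.Barriers.CriticalPhenomena.PositionSpaceRGNonGibbsianPlusPhaseProofs
import HarnessLib

/-!
# Discharges of named facts of `PositionSpaceRGNonGibbsianExtremal.lean`

`Literature/Barriers/CriticalPhenomena/PositionSpaceRGNonGibbsianExtremalHolds.lean` —
proofs-only sibling of `PositionSpaceRGNonGibbsianExtremal.lean` (no definitions, no named
facts). Each theorem below closes a named fact `X : Prop` of that file as `X_holds : X` by
composing an ACCEPTED reduction theorem of the tree with the ACCEPTED unconditional `_holds`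
discharges of all of its hypotheses; nothing is re-proved and no statement is changed.
Recorded by the librarian sweep g25 (2026-08-16, pass 5c: facts dischargeable in one line from
the tree's own lemmas), so that the facts census, `#h21_route_deps` and the cone guardrail see
these facts as theorems.

Discharged here:

* `VEFS1993_eq413_extremal_holds` := `VEFS1993_eq413_extremal_of_spacing`
  `VEFS1993_eq413_spacing_holds` (`PositionSpaceRGNonGibbsianExtremal.lean`).

## References

* [VanenterFernandezSokal1993] — see `lean/references.bib` and the docstring of the fact in `PositionSpaceRGNonGibbsianExtremal.lean`.
-/

namespace Literature.Barriers.CriticalPhenomena.NonGibbs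

/-- **Discharge of the named fact `VEFS1993_eq413_extremal`**
(`PositionSpaceRGNonGibbsianExtremal.lean`): van Enter–Fernández–Sokal 1993, eqs.
(4.26)–(4.27) (second inequalities) with Step 3, for decimation with spacing `b`: … — obtained
as `VEFS1993_eq413_extremal_of_spacing` applied to the tree's unconditional discharge
`VEFS1993_eq413_spacing_holds` of its hypothesis (reduction in
`PositionSpaceRGNonGibbsianExtremal.lean`).
[cite: VanenterFernandezSokal1993, §4.3.1 eqs. (4.26)–(4.27), §4.1.2 Step 3, §4.3.2] -/
theorem VEFS1993_eq413_extremal_holds :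
    VEFS1993_eq413_extremal :=
  VEFS1993_eq413_extremal_of_spacing VEFS1993_eq413_spacing_holds

end Literature.Barriers.CriticalPhenomena.NonGibbs
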